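import Literature.Computability.Complexity.AaronsonVanMelkebeek2011
import Literature.Computability.Complexity.ClockedUniversalAcceptance
import Literature.Computability.Complexity.ClockedUniversalAcceptanceProofs
import Literature.Computability.Complexity.NTIMEPadding
import Literature.Computability.Complexity.NPSubsetNTIME
import Literature.Computability.Complexity.StringCopy
import Literature.Computability.Complexity.PolyTimeCountable
import Literature.Computability.Complexity.CircuitClassesProofs
import Literature.Computability.Complexity.PolyAdviceClosure
import HarnessLib

/-!
# `NEXP ⊆ P/poly ⟹ NE ⊆ SIZE(nᵏ)` for one `k`, from clocked universal acceptance testing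

Sibling proof file of `AaronsonVanMelkebeek2011.lean`, for the named fact
`Literature.Computability.Complexity.NE_subset_SIZE_of_NEXP_subset_PPoly` — Aaronson–van Melkebeek
2011, §3.3, the second inclusion of display (3), `NTIME(2^{O(n)}) ⊆ SIZE(nᶜ)` for some constant
`c` under `NEXP ⊆ SIZE(poly(n))`, which "follows from our second hypothesis … and the fact that
`NTIME(2^{O(n)})` has a complete problem under linear-time reductions, e.g.
`{⟨M, x, t⟩ | M is a nondeterministic Turing machine that accepts x in at most t steps}`". The
one non-elementary ingredient of that sentence in the tree's machine model (Mathlib's `Turing.FinTM2`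
behind `NTIME`, `Nondeterministic.lean`) is an efficient clocked universal machine; it is isolated
as the named fact `clockedUniversalAcceptance` (`ClockedUniversalAcceptance.lean`: a language
`U ∈ P` of triples `⟨e, ⟨w, 1ᴺ⟩⟩`, complete and sound for acceptance by every
`Turing.TM2ComputableAux Bool Bool` with a polynomial overhead `p`), and this file PROVES

* `NE_subset_SIZE_of_NEXP_subset_PPoly_of_clockedUniversalAcceptance :
    clockedUniversalAcceptance → NE_subset_SIZE_of_NEXP_subset_PPoly`,

so that the discharge `NE_subset_SIZE_of_NEXP_subset_PPoly_holds` is reduced, without loss, to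
`clockedUniversalAcceptance_holds` (the interpreter for `FinTM2` with a verified polynomial step
count on top of the normal form `TM2Std` of `PolyTimeCountable.lean`, since landed in
`ClockedUniversalAcceptanceProofs.lean`), and CLOSES it:

* `NE_subset_SIZE_of_NEXP_subset_PPoly_holds : NE_subset_SIZE_of_NEXP_subset_PPoly`

(unconditional; axioms `propext`, `Classical.choice`, `Quot.sound`).

## The argument in the tree's model

* **The complete language** (`AvM.K U`, relative to the acceptance language `U`): instances are
  records `w = ⟨x, ⟨e, ⟨s, pad⟩⟩⟩` (nested `boolPair`), and `w ∈ K U` iff some inner witness `y`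
  with `|y| ≤ ⟦s⟧` (`s` a little-endian numeral, `bitsToNat`) makes the query
  `⟨e, ⟨⟨x, y⟩, 1^{2^{|w|}+1}⟩⟩` (`AvM.query`) a member of `U` — "`M_e` accepts `⟨x, y⟩` within
  `2^{|w|} + 1` steps", the budget `t` of the printed `⟨M, x, t⟩` being carried by the LENGTH of the
  instance (so that the reduction stays linear-length) and the admissible witness length `s` in
  binary (so that the simulated verifier is only ever run inside the range on which the tree's
  one-constant `NTIME` specifies it).
* **`K U ∈ NTIME(2^{n²}) ⊆ NEXP`** (`AvM.K_mem_NTIME`): the verifier on `⟨w, y⟩` is the truncating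
  wrapper `truncMapAux` (`TruncMapMachine.lean`) of the clock
  `w ↦ ⟨⟨w, 1^{2^{|w|}+1}⟩, 1^{2|w| + 2^{|w|} + 4}⟩` (`expClock 1 1` of `NTIMEPadding.lean`, then the
  polynomial clock of `NPSubsetNTIME.lean`) followed by a polynomial-time decider of the core
  `AvM.core U = relen⁻¹(UnLe) ⊓ relay⁻¹(U)` (the unary/binary threshold language `Kannan.UnLe` of
  `KannanLanguage.lean` = `unLeBinFn` of `UnaryLeBinary.lean` on arbitrary numerals;
  `preimage_mem_P`, `inter_mem_P`); running time
  `2^{O(|w|)} + |y| / 2 ≤ c · 2^{|w|²} + c` (`AvM.exists_time_const`), and no admissible inner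
  witness is cut since `⟦s⟧ < 2^{|s|} ≤ 2^{|w|}`.
* **The reduction** (`AvM.reduction`): for `L ∈ NTIME(2^{c₀ n})` with verifier `(c, R, M)` and
  the code/overhead `(e, p)` of `M`, `x ↦ ⟨x, ⟨e, ⟨bin (c · 2^{c₀ n} + c), 1^{P(n)}⟩⟩⟩` with
  `P(n) = O(n)` chosen so that `p(c · 2^{c₀ n} + c) ≤ 2^{P(n)}`; `x ∈ L ⟹` instance `∈ K U` by
  completeness of `U`, the converse by soundness of `U` and uniqueness of the output word of a
  deterministic machine (`AvM.outputsWithin_unique`, from `TM2Std.outputs_unique`). The appended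
  suffix depends on `|x|` only and has length `≤ α n + β`.
* **Circuits** (the assembly): `K U ∈ P/poly` gives `B₂`-circuits of size `q` for the pair map
  (`exists_cktSize_boolPair_of_mem_PPoly`), the suffix is hard-wired (`CktSize.hardwire`,
  Arora–Barak 2009, proof of Thm. 6.18), and with `k` the exponent of `X + q + 2`
  (`exists_eval_le_mul_pow_add`) every `L ∈ NE` gets circuits of size `≤ c_L · nᵏ + c_L`
  (`exists_affine_pow_le`): ONE `k`, the constant inside, as vendored.

## References

* S. Aaronson, D. van Melkebeek, *On circuit lower bounds from derandomization*, Theory of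
  Computing 7 (2011) 177–184, §2 (`SIZE`), §3.3 (display (3) and the complete problem for
  `NTIME(2^{O(n)})`). doi:10.4086/toc.2011.v007a012
* S. Arora, B. Barak, *Computational Complexity: A Modern Approach*, CUP 2009, Thm. 1.9 and
  §1.4.1 (universal TM with time bound), Thm. 2.9 (`TMSAT`), §2.6.2 (`NEXP`), Def. 6.5 and
  Thm. 6.18 (hard-wiring advice), Thm. 2.8 (closure under reductions).
-/
namespace Literature.Computability.Complexity

open _root_.Computability Turing Polynomial Brick

/-! ### Arithmetic -/

/-- `d · n ≤ d² + n²`. [folklore] -/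
theorem mul_le_sq_add_sq (d n : ℕ) : d * n ≤ d ^ 2 + n ^ 2 := by
  rcases le_total d n with h | h
  · calc d * n ≤ n * n := Nat.mul_le_mul_right n h
      _ = n ^ 2 := (sq n).symm
      _ ≤ d ^ 2 + n ^ 2 := Nat.le_add_left _ _
  · calc d * n ≤ d * d := Nat.mul_le_mul_left d h
      _ = d ^ 2 := (sq d).symm
      _ ≤ d ^ 2 + n ^ 2 := Nat.le_add_right _ _

/-- `(2ⁿ)ᵈ ≤ 2^{d²} · 2^{n²}`. [folklore] -/
theorem two_pow_pow_le (d n : ℕ) : (2 ^ n) ^ d ≤ 2 ^ (d ^ 2) * 2 ^ (n ^ 2) := by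
  rw [← pow_mul, ← pow_add, Nat.mul_comm]
  exact Nat.pow_le_pow_right two_pos (mul_le_sq_add_sq d n)

/-- A power of an affine function is `O(nᵏ)` with an explicit additive constant:
`(α n + β)ᵏ ≤ c nᵏ + c`. [folklore] -/
theorem exists_affine_pow_le (α β k : ℕ) : ∃ c : ℕ, ∀ n : ℕ, (α * n + β) ^ k ≤ c * n ^ k + c := by
  refine ⟨(α + β) ^ k + β ^ k, fun n => ?_⟩
  rcases Nat.eq_zero_or_pos n with rfl | hn
  · cases k <;> simp
  · calc (α * n + β) ^ k ≤ ((α + β) * n) ^ k :=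
          Nat.pow_le_pow_left (by nlinarith) k
      _ = (α + β) ^ k * n ^ k := mul_pow _ _ _
      _ ≤ ((α + β) ^ k + β ^ k) * n ^ k := Nat.mul_le_mul_right _ (Nat.le_add_right _ _)
      _ ≤ ((α + β) ^ k + β ^ k) * n ^ k + ((α + β) ^ k + β ^ k) := Nat.le_add_right _ _

/-- `c · 2ᵗ + c < 2^{t + c + 1}`. [folklore] -/
theorem mul_two_pow_add_lt (c t : ℕ) : c * 2 ^ t + c < 2 ^ (t + c + 1) := by
  have hc : c < 2 ^ c := Nat.lt_two_pow_self
  have h1 : 1 ≤ 2 ^ t := Nat.one_le_two_pow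
  calc c * 2 ^ t + c ≤ c * 2 ^ t + c * 2 ^ t := by nlinarith
    _ = c * 2 ^ (t + 1) := by rw [pow_succ]; ring
    _ < 2 ^ c * 2 ^ (t + 1) := Nat.mul_lt_mul_of_pos_right hc (Nat.two_pow_pos _)
    _ = 2 ^ (t + c + 1) := by rw [← pow_add]; ring_nf

/-! ### The complete language and its core -/

namespace AvM

/-- **The query to the universal acceptance language** made for an instance
`w = ⟨x, ⟨e, ⟨s, pad⟩⟩⟩` and an inner witness `y`: `⟨e, ⟨⟨x, y⟩, 1^{2^{|w|} + 1}⟩⟩` — run the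
machine coded by `e` on the pair `⟨x, y⟩` with the budget `2^{|w|} + 1` (Aaronson–van Melkebeek
2011, §3.3: the instance `⟨M, x, t⟩` of the complete problem, `t` in binary being implicit in
the instance length). [cite: AaronsonMelkebeek2011, §3.3] -/
def query (w y : List Bool) : List Bool :=
  boolPair (nthF 1 w) (boolPair (boolPair (nthF 0 w) y) (ones (2 ^ w.length + 1)))

/-- **The `NE`-complete language** relative to a bounded-acceptance language `U`
(Aaronson–van Melkebeek 2011, §3.3: "`{⟨M, x, t⟩ | M is a nondeterministic Turing machine that
accepts x in at most t steps}`", in the tree's certificate form of nondeterminism): the instances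
`w = ⟨x, ⟨e, ⟨s, pad⟩⟩⟩` such that SOME inner witness `y` of length at most the binary numeral `s`
(little-endian value `⟦s⟧ = bitsToNat s`) makes the query `⟨e, ⟨⟨x, y⟩, 1^{2^{|w|}+1}⟩⟩` a member
of `U`. [cite: AaronsonMelkebeek2011, §3.3] -/
def K (U : Language Bool) : Language Bool :=
  {w | ∃ y : List Bool, y.length ≤ bitsToNat (nthF 2 w) ∧ query w y ∈ U}

/-- Membership in `K U` (definitional). [cite: AaronsonMelkebeek2011, §3.3] -/
theorem mem_K_iff (U : Language Bool) (w : List Bool) :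
    w ∈ K U ↔ ∃ y : List Bool, y.length ≤ bitsToNat (nthF 2 w) ∧ query w y ∈ U := Iff.rfl

/-- The re-layout `⟨⟨w, o⟩, y⟩ ↦ ⟨e, ⟨⟨x, y⟩, o⟩⟩` (`x = w.0`, `e = w.1`) feeding the query to `U`
inside the verifier, as a composite of pair projections. [folklore] -/
noncomputable def relay : List Bool → List Bool :=
  fanoutFn (nthF 1 ∘ fstF ∘ fstF)
    (fanoutFn (fanoutFn (fstF ∘ fstF ∘ fstF) sndF) (sndF ∘ fstF))

/-- `relay ∈ FP`. [folklore] -/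
theorem relay_mem_FP : relay ∈ FP :=
  fanoutFn_mem_FP (comp_mem_FP (nthF_mem_FP 1) (comp_mem_FP fstF_mem_FP fstF_mem_FP))
    (fanoutFn_mem_FP
      (fanoutFn_mem_FP (comp_mem_FP fstF_mem_FP (comp_mem_FP fstF_mem_FP fstF_mem_FP)) sndF_mem_FP)
      (comp_mem_FP sndF_mem_FP fstF_mem_FP))

/-- The value of `relay` on a well-formed argument. [folklore] -/
theorem relay_apply (w o y : List Bool) :
    relay (boolPair (boolPair w o) y) = boolPair (nthF 1 w) (boolPair (boolPair (nthF 0 w) y) o) := by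
  simp [relay, Function.comp]

/-- The re-layout `⟨⟨w, o⟩, y⟩ ↦ ⟨y, w.2⟩` feeding the inner-witness length test (the
unary/binary threshold language `Kannan.UnLe` of `KannanLanguage.lean`, i.e. `unLeBinFn` of
`UnaryLeBinary.lean` on arbitrary numerals). [folklore] -/
noncomputable def relen : List Bool → List Bool :=
  fanoutFn sndF (nthF 2 ∘ fstF ∘ fstF)

/-- `relen ∈ FP`. [folklore] -/
theorem relen_mem_FP : relen ∈ FP :=
  fanoutFn_mem_FP sndF_mem_FP (comp_mem_FP (nthF_mem_FP 2) (comp_mem_FP fstF_mem_FP fstF_mem_FP))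

/-- The value of `relen` on a well-formed argument. [folklore] -/
theorem relen_apply (w o y : List Bool) :
    relen (boolPair (boolPair w o) y) = boolPair y (nthF 2 w) := by
  simp [relen, Function.comp]

/-- **The polynomial-time core of the verifier of `K U`**: the arguments `⟨⟨w, o⟩, y⟩` passing the
length test whose re-layout lies in `U`. [cite: AaronsonMelkebeek2011, §3.3] -/
def core (U : Language Bool) : Language Bool :=
  (relen ⁻¹' Kannan.UnLe) ⊓ (relay ⁻¹' U)

/-- The core is in `P` when `U` is (closure of `P` under `FP` preimages and intersection;
`Kannan.UnLe_mem_P`). [cite: AroraBarakCC2009, Thm. 2.8] -/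
theorem core_mem_P {U : Language Bool} (hU : U ∈ Classes.P) : core U ∈ Classes.P :=
  inter_mem_P (preimage_mem_P Kannan.UnLe_mem_P relen_mem_FP) (preimage_mem_P hU relay_mem_FP)

/-- Membership in the core (definitional). [folklore] -/
theorem mem_core {U : Language Bool} {z : List Bool} :
    z ∈ core U ↔ relen z ∈ Kannan.UnLe ∧ relay z ∈ U := Iff.rfl

/-- Membership of a well-formed argument in the core. [folklore] -/
theorem mem_core_iff (U : Language Bool) (w o y : List Bool) :
    boolPair (boolPair w o) y ∈ core U ↔
      y.length ≤ bitsToNat (nthF 2 w) ∧ boolPair (nthF 1 w) (boolPair (boolPair (nthF 0 w) y) o) ∈ U := by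
  rw [mem_core, relen_apply, relay_apply, Kannan.boolPair_mem_UnLe]

/-- The arithmetic of the verifier of `K U`: its witness-independent running time is
`O(2^{n²})`. [folklore] -/
theorem exists_time_const (a k C : ℕ) (q : Polynomial ℕ) : ∃ B : ℕ, ∀ n : ℕ,
    a * (3 * (2 * n + 2 ^ n + 3) + 3) ^ k + a + (q.eval (2 * n + 2 ^ n + 3) + (C * 2 ^ n + C))
      + 3 * (2 * n + 2 ^ n + 3) + 2 * (2 * n + 2 ^ n + 3 + 1) + 2 * n + 11 ≤ B * 2 ^ (n ^ 2) + B := by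
  obtain ⟨A, d, hA⟩ := exists_eval_le_mul_pow_add q
  refine ⟨a * 21 ^ k * 2 ^ (k ^ 2) + A * 6 ^ d * 2 ^ (d ^ 2) + 2 * C + 64 + (a + A + C + 13),
    fun n => ?_⟩
  set m := 2 ^ n with hm
  have hm1 : 1 ≤ m := Nat.one_le_two_pow
  have hnm : n ≤ m := Nat.lt_two_pow_self.le
  have hP : m ≤ 2 * 2 ^ (n ^ 2) := by
    have : 2 ^ n ≤ 2 ^ (n ^ 2) := Nat.pow_le_pow_right two_pos (Nat.le_self_pow two_ne_zero n)
    omega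
  have h1 : a * (3 * (2 * n + m + 3) + 3) ^ k ≤ a * 21 ^ k * 2 ^ (k ^ 2) * 2 ^ (n ^ 2) := by
    have h : 3 * (2 * n + m + 3) + 3 ≤ 21 * m := by omega
    calc a * (3 * (2 * n + m + 3) + 3) ^ k ≤ a * (21 * m) ^ k :=
          Nat.mul_le_mul_left a (Nat.pow_le_pow_left h k)
      _ = a * 21 ^ k * m ^ k := by rw [mul_pow, mul_assoc]
      _ ≤ a * 21 ^ k * (2 ^ (k ^ 2) * 2 ^ (n ^ 2)) := Nat.mul_le_mul_left _ (two_pow_pow_le k n)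
      _ = a * 21 ^ k * 2 ^ (k ^ 2) * 2 ^ (n ^ 2) := by ring
  have h2 : q.eval (2 * n + m + 3) ≤ A * 6 ^ d * 2 ^ (d ^ 2) * 2 ^ (n ^ 2) + A := by
    have h : 2 * n + m + 3 ≤ 6 * m := by omega
    calc q.eval (2 * n + m + 3) ≤ A * (2 * n + m + 3) ^ d + A := hA _
      _ ≤ A * (6 * m) ^ d + A := by gcongr
      _ = A * 6 ^ d * m ^ d + A := by rw [mul_pow, mul_assoc]
      _ ≤ A * 6 ^ d * (2 ^ (d ^ 2) * 2 ^ (n ^ 2)) + A := by gcongr; exact two_pow_pow_le d n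
      _ = A * 6 ^ d * 2 ^ (d ^ 2) * 2 ^ (n ^ 2) + A := by ring
  have h3 : C * m + C + 3 * (2 * n + m + 3) + 2 * (2 * n + m + 3 + 1) + 2 * n + 11 ≤
      (2 * C + 64) * 2 ^ (n ^ 2) + (C + 13) := by
    have e1 : C * m ≤ C * (2 * 2 ^ (n ^ 2)) := Nat.mul_le_mul_left C hP
    have e2 : (2 * C + 64) * 2 ^ (n ^ 2) = C * (2 * 2 ^ (n ^ 2)) + 64 * 2 ^ (n ^ 2) := by ring
    omega
  have step : a * (3 * (2 * n + m + 3) + 3) ^ k + a + (q.eval (2 * n + m + 3) + (C * m + C))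
      + 3 * (2 * n + m + 3) + 2 * (2 * n + m + 3 + 1) + 2 * n + 11 ≤
      (a * 21 ^ k * 2 ^ (k ^ 2) * 2 ^ (n ^ 2) + a) + ((A * 6 ^ d * 2 ^ (d ^ 2) * 2 ^ (n ^ 2) + A)
        + ((2 * C + 64) * 2 ^ (n ^ 2) + (C + 13))) := by
    have e : a * (3 * (2 * n + m + 3) + 3) ^ k + a + (q.eval (2 * n + m + 3) + (C * m + C))
        + 3 * (2 * n + m + 3) + 2 * (2 * n + m + 3 + 1) + 2 * n + 11 =
        (a * (3 * (2 * n + m + 3) + 3) ^ k + a) + (q.eval (2 * n + m + 3)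
          + (C * m + C + 3 * (2 * n + m + 3) + 2 * (2 * n + m + 3 + 1) + 2 * n + 11)) := by ring
    rw [e]
    exact Nat.add_le_add (Nat.add_le_add_right h1 a) (Nat.add_le_add h2 h3)
  refine step.trans ?_
  have e3 : (a * 21 ^ k * 2 ^ (k ^ 2) + A * 6 ^ d * 2 ^ (d ^ 2) + 2 * C + 64 + (a + A + C + 13))
      * 2 ^ (n ^ 2) = a * 21 ^ k * 2 ^ (k ^ 2) * 2 ^ (n ^ 2) + A * 6 ^ d * 2 ^ (d ^ 2) * 2 ^ (n ^ 2)
        + (2 * C + 64) * 2 ^ (n ^ 2) + (a + A + C + 13) * 2 ^ (n ^ 2) := by ring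
  rw [e3]
  omega

/-- `expClock 1 1 w = ⟨w, 1^{2^{|w|} + 1}⟩`. [folklore] -/
theorem expClock_one_one (w : List Bool) : expClock 1 1 w = boolPair w (ones (2 ^ w.length + 1)) := by
  simp [expClock, ones]

/-- **`K U ∈ NTIME(2^{n²})` for `U ∈ P`.** The verifier on `⟨w, y⟩` is the truncating wrapper
`truncMapAux` (`TruncMapMachine.lean`) of the clock `w ↦ ⟨⟨w, 1^{2^{|w|}+1}⟩, 1^{|⟨w, 1^{2^{|w|}+1}⟩| + 1}⟩`
(the exponential clock `expClock 1 1` of `NTIMEPadding.lean` followed by the polynomial clock of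
`NPSubsetNTIME.exists_machine_pair_ones`) — output `⟨⟨w, 1^{2^{|w|}+1}⟩, y ↾ (2|w| + 2^{|w|} + 4)⟩`
within `2^{O(|w|)} + |y| / 2` steps — followed by the polynomial-time decider of `core U`; no
admissible inner witness is lost by the truncation since `⟦w.2⟧ < 2^{|w|}`. (Guess-and-verify with
a clocked universal machine: Arora–Barak 2009, Thm. 2.9 / §2.1.2, here at exponential scale as in
Aaronson–van Melkebeek 2011, §3.3, "`NTIME(2^{O(n)})` has a complete problem".)
[cite: AaronsonMelkebeek2011, §3.3] -/
theorem K_mem_NTIME {U : Language Bool} (hU : U ∈ Classes.P) :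
    K U ∈ NTIME (fun n => 2 ^ (n ^ 2)) := by
  -- a decider of the core
  have hD := core_mem_P hU
  simp only [Classes.P, Set.mem_iUnion] at hD
  obtain ⟨k, a, hdec⟩ := hD
  obtain ⟨MD, hMD⟩ := (hdec : TimeDecidable id (core U) fun n => a * n ^ k + a)
  -- the clocks
  obtain ⟨C, F, hF⟩ := exists_timeComputable_expClock 1 (k := 1) le_rfl
  obtain ⟨q, G, hG⟩ := exists_machine_pair_ones (X : Polynomial ℕ)
  obtain ⟨B, hB⟩ := exists_time_const a k C q
  let V : TM2ComputableAux Bool Bool := (truncMapAux (F.comp G)).comp MD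
  refine ⟨2 * B + 2, fun w y => (core U).boolIndicator
      (boolPair (expClock 1 1 w) (y.take ((expClock 1 1 w).length + 1))), V,
    fun w y hy => ?_, fun w => ?_⟩
  · -- running time
    have hFw : F.OutputsWithin w (expClock 1 1 w) (C * 2 ^ (w.length ^ 1) + C) := hF w
    have hGw := hG (expClock 1 1 w)
    simp only [eval_X] at hGw
    have hNc := TM2ComputableAux.comp_outputsWithin F G hFw hGw
    have h₁ := outputsWithin_truncMapAux_boolPair (F.comp G) (y := y) hNc
    simp only [List.length_replicate] at h₁
    have h₂ : MD.OutputsWithin (boolPair (expClock 1 1 w) (y.take ((expClock 1 1 w).length + 1)))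
        (encodeBool ((core U).boolIndicator
          (boolPair (expClock 1 1 w) (y.take ((expClock 1 1 w).length + 1)))))
        (a * (3 * (expClock 1 1 w).length + 3) ^ k + a) := by
      refine (hMD (boolPair (expClock 1 1 w) (y.take ((expClock 1 1 w).length + 1)))).mono ?_
      simp only [id, length_boolPair]
      have : (y.take ((expClock 1 1 w).length + 1)).length ≤ (expClock 1 1 w).length + 1 :=
        List.length_take_le _ _
      exact Nat.add_le_add_right (Nat.mul_le_mul_left a (Nat.pow_le_pow_left (by omega) k)) a
    have h := TM2ComputableAux.comp_outputsWithin _ _ h₁ h₂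
    refine h.mono ?_
    have hℓ : (expClock 1 1 w).length = 2 * w.length + 2 ^ w.length + 3 := by
      simp only [length_expClock, pow_one, one_mul]; omega
    rw [hℓ, pow_one]
    have hBn := hB w.length
    have hP2 : (2 * B + 2) * 2 ^ (w.length ^ 2) = 2 * (B * 2 ^ (w.length ^ 2)) + 2 * 2 ^ (w.length ^ 2) := by
      ring
    have hy2 : 2 * (y.length / 2) ≤ 2 * (B * 2 ^ (w.length ^ 2)) + 2 * 2 ^ (w.length ^ 2) + (2 * B + 2) :=
      (Nat.mul_div_le y.length 2).trans (hP2 ▸ hy)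
    show _ ≤ (2 * B + 2) * 2 ^ (w.length ^ 2) + (2 * B + 2)
    rw [hP2]
    omega
  · -- correctness
    have hind : ∀ z : List Bool, (core U).boolIndicator z = true ↔ z ∈ core U :=
      fun z => (Set.mem_iff_boolIndicator _ _).symm
    have ho := expClock_one_one w
    have hlt : bitsToNat (nthF 2 w) < 2 ^ w.length :=
      (bitsToNat_lt _).trans_le (Nat.pow_le_pow_right two_pos (length_nthF_le 2 w))
    have hℓ : (expClock 1 1 w).length = 2 * w.length + 2 ^ w.length + 3 := by
      simp only [length_expClock, pow_one, one_mul]; omega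
    rw [mem_K_iff]
    constructor
    · rintro ⟨y, hy, hq⟩
      refine ⟨y, ?_, ?_⟩
      · show y.length ≤ (2 * B + 2) * 2 ^ (w.length ^ 2) + (2 * B + 2)
        have h2 : 2 ^ w.length ≤ 2 ^ (w.length ^ 2) :=
          Nat.pow_le_pow_right two_pos (Nat.le_self_pow two_ne_zero _)
        nlinarith
      · rw [hind, List.take_of_length_le (by omega), ho, mem_core_iff]
        exact ⟨hy, hq⟩
    · rintro ⟨y, -, hR⟩
      rw [hind, ho, mem_core_iff] at hR
      exact ⟨_, hR.1, hR.2⟩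

end AvM


/-! ### The reduction of `NE` to `K U` -/

namespace AvM

/-- A deterministic machine has at most one output word on a given input (the `OutputsWithin`
form of `TM2Std.outputs_unique`). [folklore] -/
theorem outputsWithin_unique {Γ₀ Γ₁ : Type} (M : TM2ComputableAux Γ₀ Γ₁) {l : List Γ₀}
    {l₁ l₂ : List Γ₁} {m₁ m₂ : ℕ} (h₁ : M.OutputsWithin l l₁ m₁) (h₂ : M.OutputsWithin l l₂ m₂) :
    l₁ = l₂ :=
  List.map_injective_iff.2 M.outputAlphabet.symm.injective (TM2Std.outputs_unique M.tm h₁ h₂)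

/-- **Every `NTIME(2^{c₀ n})` language reduces to `K U` by appending a suffix depending on the
input length only** (Aaronson–van Melkebeek 2011, §3.3: the linear-time reduction
`x ↦ ⟨M_L, x, t_L(|x|)⟩` to the complete problem). Given a verifier `(c, R, M)` of `L` and the
code `e` / overhead `p` of `M` for the acceptance language `U`, the instance of `x` is
`⟨x, ⟨e, ⟨bin s, 1ᴾ⟩⟩⟩` with `s = c · 2^{c₀ n} + c` — the EXACT admissible witness length of `M`,
so that `M` is specified on every inner witness `K U` quantifies over — and a pad of length
`P = O(n)` making the budget `2^{|instance|} + 1 ≥ p(s)`; completeness of `U` gives `x ∈ L ⟹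
instance ∈ K U`, soundness of `U` with uniqueness of outputs (`outputsWithin_unique`) the
converse. The suffix has length `≤ α n + β`. [cite: AaronsonMelkebeek2011, §3.3] -/
theorem reduction {U : Language Bool}
    (hUniv : ∀ M : TM2ComputableAux Bool Bool, ∃ (e : List Bool) (p : Polynomial ℕ),
      (∀ (w : List Bool) (t N : ℕ), M.OutputsWithin w [true] t → p.eval t ≤ N →
          boolPair e (boolPair w (List.replicate N true)) ∈ U) ∧
      (∀ (w : List Bool) (N : ℕ), boolPair e (boolPair w (List.replicate N true)) ∈ U →
          ∃ t : ℕ, M.OutputsWithin w [true] t))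
    {L : Language Bool} {c₀ : ℕ} (hL : L ∈ NTIME (fun n => 2 ^ (c₀ * n))) :
    ∃ adv : ℕ → List Bool, (∃ α β : ℕ, ∀ n, (adv n).length ≤ α * n + β) ∧
      ∀ x : List Bool, x ∈ L ↔ boolPair x (adv x.length) ∈ K U := by
  obtain ⟨c, R, M, hM, hLR⟩ := hL
  obtain ⟨e, p, hcomp, hsound⟩ := hUniv M
  obtain ⟨A, d, hp⟩ := exists_eval_le_mul_pow_add p
  -- the admissible witness length (= time bound) of `M` and the pad length
  let s : ℕ → ℕ := fun n => c * 2 ^ (c₀ * n) + c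
  let P : ℕ → ℕ := fun n => A + (c₀ * n + c + 1) * d + 1
  refine ⟨fun n => boolPair e (boolPair (encodeNat (s n)) (ones (P n))),
    ⟨2 * c₀ + c₀ * d, 2 * e.length + 2 * c + A + (c + 1) * d + 7, fun n => ?_⟩, fun x => ?_⟩
  · -- length of the suffix
    have hs : (encodeNat (s n)).length ≤ c₀ * n + c + 1 := by
      rw [TM2Pass.length_encodeNat_eq_size]
      exact Nat.size_le.2 (mul_two_pow_add_lt c (c₀ * n))
    simp only [length_boolPair, List.length_replicate, P]
    nlinarith
  · -- the reduction
    show x ∈ L ↔ boolPair x (boolPair e (boolPair (encodeNat (s x.length)) (ones (P x.length)))) ∈ K U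
    set n := x.length with hn
    set w := boolPair x (boolPair e (boolPair (encodeNat (s n)) (ones (P n)))) with hw
    have h0 : nthF 0 w = x := by rw [hw, nthF_zero_boolPair]
    have h1 : nthF 1 w = e := by rw [hw, nthF_succ_boolPair, nthF_zero_boolPair]
    have h2 : nthF 2 w = encodeNat (s n) := by
      rw [hw, nthF_succ_boolPair, nthF_succ_boolPair, nthF_zero_boolPair]
    have hbudget : p.eval (s n) ≤ 2 ^ w.length + 1 := by
      have hT : s n < 2 ^ (c₀ * n + c + 1) := mul_two_pow_add_lt c (c₀ * n)
      have hA : A ≤ 2 ^ A := Nat.lt_two_pow_self.le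
      have hPw : P n ≤ w.length := by
        simp only [hw, length_boolPair, List.length_replicate]; omega
      have h1le : 1 ≤ 2 ^ ((c₀ * n + c + 1) * d) := Nat.one_le_two_pow
      calc p.eval (s n) ≤ A * s n ^ d + A := hp _
        _ ≤ A * (2 ^ (c₀ * n + c + 1)) ^ d + A := by gcongr
        _ = A * 2 ^ ((c₀ * n + c + 1) * d) + A := by rw [← pow_mul]
        _ ≤ 2 ^ A * 2 ^ ((c₀ * n + c + 1) * d) + 2 ^ A * 2 ^ ((c₀ * n + c + 1) * d) := by
            nlinarith
        _ = 2 ^ (P n) := by simp only [P]; rw [← pow_add, ← two_mul, ← pow_succ']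
        _ ≤ 2 ^ w.length := Nat.pow_le_pow_right two_pos hPw
        _ ≤ 2 ^ w.length + 1 := Nat.le_succ _
    have hquery : ∀ y : List Bool, query w y =
        boolPair e (boolPair (boolPair x y) (List.replicate (2 ^ w.length + 1) true)) := by
      intro y; rw [query, h1, h0]
    rw [mem_K_iff, h2, bitsToNat_encodeNat]
    constructor
    · intro hx
      obtain ⟨y, hy, hRy⟩ := (hLR x).1 hx
      have hMy : M.OutputsWithin (boolPair x y) [true] (s n) := by
        have := hM x y hy
        rwa [hRy] at this
      exact ⟨y, hy, by rw [hquery]; exact hcomp _ _ _ hMy hbudget⟩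
    · rintro ⟨y, hy, hq⟩
      rw [hquery] at hq
      obtain ⟨t, ht⟩ := hsound _ _ hq
      have heq := outputsWithin_unique M ht (hM x y hy)
      have hR : R x y = true := by
        have he : encodeBool (R x y) = [R x y] := rfl
        rw [he] at heq
        simpa using heq.symm
      exact (hLR x).2 ⟨y, hy, hR⟩

end AvM

/-! ### Assembly -/

open AvM in
/-- **`NEXP ⊆ P/poly ⟹ NE ⊆ ⋃_c SIZE(c·nᵏ + c)` for ONE exponent `k`, from clocked universal
acceptance testing** (Aaronson–van Melkebeek 2011, §3.3, second inclusion of display (3):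
"follows from our second hypothesis (`NEXP ⊆ SIZE(poly(n))`) and the fact that `NTIME(2^{O(n)})`
has a complete problem under linear-time reductions"). With `U ∈ P` the acceptance language,
`K U ∈ NTIME(2^{n²}) ⊆ NEXP ⊆ P/poly` (`K_mem_NTIME`) has `B₂`-circuits of polynomial size `q`
on pairs (`exists_cktSize_boolPair_of_mem_PPoly`); `k` is the exponent of `X + q + 2`. For
`L ∈ NTIME(2^{c₀ n})`, `x ∈ L ↔ ⟨x, adv(|x|)⟩ ∈ K U` with `|adv n| ≤ α n + β` (`reduction`), and
hard-wiring `adv n` (`CktSize.hardwire`, Arora–Barak 2009, proof of Thm. 6.18) gives circuits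
for `L` of size `≤ N + q(N) + 2`, `N = 2n + 2 + |adv n| ≤ (2+α) n + (2+β)`, i.e.
`≤ c · nᵏ + c`. [cite: AaronsonMelkebeek2011, §3.3 (display (3), second inclusion)] -/
theorem NE_subset_SIZE_of_NEXP_subset_PPoly_of_clockedUniversalAcceptance
    (hUA : clockedUniversalAcceptance) : NE_subset_SIZE_of_NEXP_subset_PPoly := by
  intro hNP
  obtain ⟨U, hUP, hUniv⟩ := hUA
  -- `K U ∈ NEXP ⊆ P/poly`
  have hKP : K U ∈ PPoly := hNP (Set.mem_iUnion.2 ⟨2, K_mem_NTIME hUP⟩)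
  obtain ⟨q, hq⟩ := exists_cktSize_boolPair_of_mem_PPoly hKP
  obtain ⟨aK, k, hk⟩ := exists_eval_le_mul_pow_add (X + q + 2 : Polynomial ℕ)
  refine ⟨k, fun L hL => ?_⟩
  simp only [NE, Set.mem_iUnion] at hL
  obtain ⟨c₀, hL⟩ := hL
  obtain ⟨adv, ⟨α, β, hlen⟩, hred⟩ := reduction hUniv hL
  obtain ⟨cp, hcp⟩ := exists_affine_pow_le (2 + α) (2 + β) k
  refine Set.mem_iUnion.2 ⟨aK * cp + aK, ?_⟩
  have main : ∀ n : ℕ, ∃ D : Circuit (Fin n), D.IsOver B2 ∧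
      D.size ≤ (aK * cp + aK) * n ^ k + (aK * cp + aK) ∧
      ∀ u : Fin n → Bool, D.eval u = L.boolIndicator (List.ofFn u) := by
    intro n
    obtain ⟨D, hDB, hDs, hDe⟩ := ((hq n (adv n).length).hardwire (adv n).get).toCircuit
    refine ⟨D, hDB, hDs.trans ?_, fun u => (hDe u).trans ?_⟩
    · set N := 2 * n + 2 + (adv n).length with hN
      have h1 : N + q.eval N + 2 ≤ aK * N ^ k + aK := by
        have := hk N
        simpa using this
      have hNle : N ≤ (2 + α) * n + (2 + β) := by have := hlen n; rw [hN]; nlinarith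
      have h2 : N ^ k ≤ cp * n ^ k + cp := (Nat.pow_le_pow_left hNle k).trans (hcp n)
      have h3 : aK * N ^ k ≤ aK * cp * n ^ k + aK * cp := by
        have := Nat.mul_le_mul_left aK h2
        rwa [Nat.mul_add, ← Nat.mul_assoc] at this
      have e2 : (aK * cp + aK) * n ^ k + (aK * cp + aK) = aK * cp * n ^ k + aK * n ^ k + (aK * cp + aK) := by
        ring
      rw [e2]
      omega
    · simp only [Sum.elim_inl, Sum.elim_inr, List.ofFn_get]
      exact boolIndicator_eq_of_iff ((hred (List.ofFn u)).trans (by rw [List.length_ofFn])).symm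
  choose D hD using main
  exact ⟨D, fun n => ⟨(hD n).1, (hD n).2.1⟩, fun x => by
    have := (hD x.length).2.2 x.get
    rwa [List.ofFn_get] at this⟩

/-- **Discharge of `NE_subset_SIZE_of_NEXP_subset_PPoly`** (Aaronson–van Melkebeek 2011, §3.3,
second inclusion of display (3): "`NTIME(2^{O(n)}) ⊆ SIZE(nᶜ)` for some constant `c`" under
`NEXP ⊆ SIZE(poly(n))`, which "follows from our second hypothesis … and the fact that
`NTIME(2^{O(n)})` has a complete problem under linear-time reductions"): the reduction to clocked
universal acceptance testing (`NE_subset_SIZE_of_NEXP_subset_PPoly_of_clockedUniversalAcceptance`)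
applied to its discharge `clockedUniversalAcceptance_holds` (`ClockedUniversalAcceptanceProofs.lean`,
Arora–Barak 2009, Thm. 1.9 with §1.4.1). In the tree's classes: `NEXP ⊆ P/poly ⟹ ∃ k, NE ⊆ ⋃_c
SIZE(c·nᵏ + c)`. [cite: AaronsonMelkebeek2011, §3.3 (display (3), second inclusion)] -/
theorem NE_subset_SIZE_of_NEXP_subset_PPoly_holds : NE_subset_SIZE_of_NEXP_subset_PPoly :=
  NE_subset_SIZE_of_NEXP_subset_PPoly_of_clockedUniversalAcceptance clockedUniversalAcceptance_holds

end Literature.Computability.Complexity
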